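import Mathlib
import HarnessLib

/-!
# `C¹` parametrization of a polygonal path by smoothstep reparametrization of its edges

Topic `Analysis/Calculus`. Given finitely many points `A₀, …, Aₙ` of `ℂ` (any normed space would do; we state it for `ℂ`, where
it serves complex contour arguments), the polygonal path through them admits a `C¹` parametrization `y : [0, n] → ℂ` which
traverses the edge `[A_k, A_{k+1}]` on the parameter interval `[k, k+1]` with the cubic "smoothstep" profile
`φ(s) = 3s² − 2s³` (`φ(0) = 0`, `φ(1) = 1`, `φ′(s) = 6s(1 − s) ≥ 0`, `φ′(0) = φ′(1) = 0`): the parametrization STOPS at each vertex,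
so the concatenation is continuously differentiable on the whole real line although the polygon has corners. This is the standard
way to feed a piecewise-linear contour to a real-variable ODE / integrating-factor argument that wants a single `C¹` parameter
interval (the sign conditions on the tangent are invariant under the non-negative reparametrization factor `φ′`).

* `exists_smoothstep_polygon` — existence of `y, y′ : ℝ → ℂ`, continuous, `HasDerivAt y (y′ σ) σ` for EVERY real `σ`,
  `y 0 = A₀`, `y n = Aₙ`, `y′ 0 = y′ n = 0`, on `[k, k+1]`: `y σ ∈ [A_k, A_{k+1}]` with `y′ σ = c • (A_{k+1} − A_k)`, `c ≥ 0`, and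
  `∫_k^{k+1} ‖y′‖ = ‖A_{k+1} − A_k‖` (the edge is traversed exactly once);
* `exists_fin_mem_Icc` — every `σ ∈ [0, n]` lies in some parameter cell `[k, k+1]`, `k < n`.

Everything is proved; no definitions (the path is packaged existentially), no named facts. Folklore.
-/

noncomputable section

open Set Filter MeasureTheory intervalIntegral
open scoped Topology

namespace Literature.Analysis.Calculus

/-! ## The smoothstep profile -/

/-- `∫₀¹ 6 s (1 − s) ds = 1`: the smoothstep traverses its edge exactly once. [folklore] -/
theorem integral_smoothstep_deriv : ∫ s in (0 : ℝ)..1, 6 * s * (1 - s) = 1 := by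
  have h : ∀ s ∈ uIcc (0 : ℝ) 1, HasDerivAt (fun s : ℝ => 3 * s ^ 2 - 2 * s ^ 3) (6 * s * (1 - s)) s := fun s _ => by
    refine (((hasDerivAt_pow 2 s).const_mul 3).sub ((hasDerivAt_pow 3 s).const_mul 2)).congr_deriv ?_
    push_cast; ring
  rw [integral_eq_sub_of_hasDerivAt h (Continuous.intervalIntegrable (by fun_prop) 0 1)]
  norm_num

/-- One smoothstepped edge `σ ↦ P + φ(σ − a)(Q − P)` as a globally differentiable path, with derivative
`6(σ − a)(1 − (σ − a)) • (Q − P)`. [folklore] -/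
theorem hasDerivAt_smoothstep_edge (P Q : ℂ) (a σ : ℝ) :
    HasDerivAt (fun σ : ℝ => P + ((3 * (σ - a) ^ 2 - 2 * (σ - a) ^ 3 : ℝ) : ℂ) * (Q - P))
      (((6 * (σ - a) * (1 - (σ - a)) : ℝ) : ℂ) * (Q - P)) σ := by
  have h0 : HasDerivAt (fun s : ℝ => 3 * s ^ 2 - 2 * s ^ 3) (6 * (σ - a) * (1 - (σ - a))) (σ - a) := by
    refine (((hasDerivAt_pow 2 (σ - a)).const_mul 3).sub ((hasDerivAt_pow 3 (σ - a)).const_mul 2)).congr_deriv ?_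
    push_cast; ring
  have h1 : HasDerivAt (fun σ : ℝ => 3 * (σ - a) ^ 2 - 2 * (σ - a) ^ 3) (6 * (σ - a) * (1 - (σ - a))) σ :=
    HasDerivAt.comp_sub_const σ a h0
  have h2 := (h1.ofReal_comp.mul_const (Q - P)).const_add P
  exact h2

/-! ## The polygon -/

/-- **`C¹` SMOOTHSTEP PARAMETRIZATION OF A POLYGONAL PATH.** For vertices `A : Fin (n+1) → ℂ` there are `y, y′ : ℝ → ℂ`, both
continuous, with `HasDerivAt y (y′ σ) σ` for every real `σ`, `y 0 = A 0`, `y n = A n`, `y′ 0 = y′ n = 0`, such that on each parameter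
cell `[k, k+1]` (`k < n`) the point `y σ` lies on the edge `[A_k, A_{k+1}]` and `y′ σ = c • (A_{k+1} − A_k)` with `c ≥ 0`, and each
edge is traversed exactly once: `∫_k^{k+1} ‖y′‖ = ‖A_{k+1} − A_k‖`. (Induction on `n`, gluing one smoothstepped edge at a time; the
one-sided derivatives at the junction both vanish.) [folklore] -/
theorem exists_smoothstep_polygon : ∀ (n : ℕ) (A : Fin (n + 1) → ℂ), ∃ y dy : ℝ → ℂ, Continuous y ∧ Continuous dy ∧
    (∀ σ : ℝ, HasDerivAt y (dy σ) σ) ∧ y 0 = A 0 ∧ y n = A (Fin.last n) ∧ dy 0 = 0 ∧ dy n = 0 ∧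
    (∀ k : Fin n, ∀ σ ∈ Icc (k : ℝ) (k + 1), ∃ s ∈ Icc (0 : ℝ) 1, ∃ c : ℝ, 0 ≤ c ∧
      y σ = A k.castSucc + (s : ℂ) * (A k.succ - A k.castSucc) ∧ dy σ = (c : ℂ) * (A k.succ - A k.castSucc)) ∧
    (∀ k : Fin n, ∫ σ in (k : ℝ)..(k + 1), ‖dy σ‖ = ‖A k.succ - A k.castSucc‖) := by
  intro n
  induction n with
  | zero =>
    intro A
    refine ⟨fun _ => A 0, fun _ => 0, continuous_const, continuous_const, fun σ => hasDerivAt_const σ (A 0), rfl, ?_, rfl, rfl,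
      fun k => k.elim0, fun k => k.elim0⟩
    simp
  | succ n ih =>
    intro A
    obtain ⟨y₁, dy₁, hy₁c, hdy₁c, hder₁, hy₁0, hy₁n, hdy₁0, hdy₁n, hcell₁, hint₁⟩ := ih (fun k => A k.castSucc)
    -- the new edge from `A n` to `A (n+1)` on `[n, n+1]`
    set P : ℂ := A (Fin.last n).castSucc with hP
    set Q : ℂ := A (Fin.last (n + 1)) with hQ
    set y₂ : ℝ → ℂ := fun σ => P + ((3 * (σ - n) ^ 2 - 2 * (σ - n) ^ 3 : ℝ) : ℂ) * (Q - P) with hy₂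
    set dy₂ : ℝ → ℂ := fun σ => ((6 * (σ - n) * (1 - (σ - n)) : ℝ) : ℂ) * (Q - P) with hdy₂
    have hder₂ : ∀ σ, HasDerivAt y₂ (dy₂ σ) σ := fun σ => hasDerivAt_smoothstep_edge P Q n σ
    have hy₂c : Continuous y₂ := continuous_iff_continuousAt.2 fun σ => (hder₂ σ).continuousAt
    have hdy₂c : Continuous dy₂ := by simp only [hdy₂]; fun_prop
    have hy₂n : y₂ n = P := by simp [hy₂]
    have hdy₂n : dy₂ n = 0 := by simp [hdy₂]
    have hy₁n' : y₁ n = P := by rw [hy₁n]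
    -- the glued path
    set y : ℝ → ℂ := fun σ => if σ ≤ n then y₁ σ else y₂ σ with hy
    set dy : ℝ → ℂ := fun σ => if σ ≤ n then dy₁ σ else dy₂ σ with hdy
    have hyc : Continuous y := Continuous.if_le hy₁c hy₂c continuous_id continuous_const fun σ hσ => by
      rw [hσ, hy₁n', hy₂n]
    have hdyc : Continuous dy := Continuous.if_le hdy₁c hdy₂c continuous_id continuous_const fun σ hσ => by
      rw [hσ, hdy₁n, hdy₂n]
    have hy_le : ∀ σ : ℝ, σ ≤ (n : ℝ) → y σ = y₁ σ := fun σ hσ => by simp [hy, hσ]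
    have hy_ge : ∀ σ : ℝ, (n : ℝ) ≤ σ → y σ = y₂ σ := fun σ hσ => by
      rcases hσ.eq_or_lt with h | h
      · simp [hy, ← h, hy₁n', hy₂n]
      · simp [hy, not_le.2 h]
    have hdy_le : ∀ σ : ℝ, σ ≤ (n : ℝ) → dy σ = dy₁ σ := fun σ hσ => by simp [hdy, hσ]
    have hdy_ge : ∀ σ : ℝ, (n : ℝ) ≤ σ → dy σ = dy₂ σ := fun σ hσ => by
      rcases hσ.eq_or_lt with h | h
      · simp [hdy, ← h, hdy₁n, hdy₂n]
      · simp [hdy, not_le.2 h]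
    -- differentiability everywhere
    have hder : ∀ σ, HasDerivAt y (dy σ) σ := by
      intro σ
      rcases lt_trichotomy σ n with h | h | h
      · have hev : y =ᶠ[𝓝 σ] y₁ := by
          filter_upwards [Iio_mem_nhds h] with τ hτ using hy_le τ (le_of_lt hτ)
        rw [hdy_le σ h.le]
        exact (hder₁ σ).congr_of_eventuallyEq hev
      · subst h
        rw [hdy_le n le_rfl, hdy₁n]
        have hl : HasDerivWithinAt y 0 (Iic (n : ℝ)) n :=
          (hdy₁n ▸ (hder₁ n).hasDerivWithinAt).congr (fun τ hτ => hy_le τ hτ) (hy_le n le_rfl)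
        have hr : HasDerivWithinAt y 0 (Ici (n : ℝ)) n :=
          (hdy₂n ▸ (hder₂ n).hasDerivWithinAt).congr (fun τ hτ => hy_ge τ hτ) (hy_ge n le_rfl)
        have := hl.union hr
        rwa [Iic_union_Ici, hasDerivWithinAt_univ] at this
      · have hev : y =ᶠ[𝓝 σ] y₂ := by
          filter_upwards [Ioi_mem_nhds h] with τ hτ using hy_ge τ (le_of_lt hτ)
        rw [hdy_ge σ h.le]
        exact (hder₂ σ).congr_of_eventuallyEq hev
    refine ⟨y, dy, hyc, hdyc, hder, ?_, ?_, ?_, ?_, ?_, ?_⟩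
    · rw [hy_le (0 : ℝ) (Nat.cast_nonneg n), hy₁0]; rfl
    · rw [Nat.cast_succ, hy_ge _ (by linarith)]
      simp [hy₂]; ring
    · rw [hdy_le (0 : ℝ) (Nat.cast_nonneg n), hdy₁0]
    · rw [Nat.cast_succ, hdy_ge _ (by linarith)]
      simp [hdy₂]
    · -- the cells
      intro k σ hσ
      by_cases hk : (k : ℕ) < n
      · -- an old cell: `σ ≤ n`, `y = y₁` there
        set k' : Fin n := ⟨k, hk⟩ with hk'
        have hσn : σ ≤ n := by
          have : (k : ℝ) + 1 ≤ n := by exact_mod_cast hk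
          exact hσ.2.trans this
        obtain ⟨s, hs, c, hc, e1, e2⟩ := hcell₁ k' σ (by simpa [hk'] using hσ)
        refine ⟨s, hs, c, hc, ?_, ?_⟩
        · rw [hy_le σ hσn, e1]; rfl
        · rw [hdy_le σ hσn, e2]; rfl
      · -- the new cell `k = n`
        have hkn : (k : ℕ) = n := by omega
        have hkr : (k : ℝ) = n := by exact_mod_cast hkn
        rw [hkr] at hσ
        have e1 : A k.castSucc = P := by
          rw [hP]; congr 1; ext; simp [hkn]
        have e2 : A k.succ = Q := by
          rw [hQ]; congr 1; ext; simp [hkn]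
        have hu0 : 0 ≤ σ - n := by linarith [hσ.1]
        have hu1 : σ - n ≤ 1 := by linarith [hσ.2]
        refine ⟨3 * (σ - n) ^ 2 - 2 * (σ - n) ^ 3, ⟨?_, ?_⟩, 6 * (σ - n) * (1 - (σ - n)), ?_, ?_, ?_⟩
        · nlinarith [mul_nonneg (sq_nonneg (σ - n)) (by linarith : (0 : ℝ) ≤ 3 - 2 * (σ - n))]
        · nlinarith [mul_nonneg (sq_nonneg (1 - (σ - n))) (by linarith : (0 : ℝ) ≤ 1 + 2 * (σ - n))]
        · exact mul_nonneg (by linarith) (by linarith)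
        · rw [hy_ge σ hσ.1, e1, e2]
        · rw [hdy_ge σ hσ.1, e1, e2]
    · -- the edge lengths
      intro k
      by_cases hk : (k : ℕ) < n
      · set k' : Fin n := ⟨k, hk⟩ with hk'
        have hle : (k : ℝ) + 1 ≤ n := by exact_mod_cast hk
        have f1 : A k.succ = A k'.succ.castSucc := by congr 1
        have f2 : A k.castSucc = A k'.castSucc.castSucc := by congr 1
        have hkk : ((k' : ℕ) : ℝ) = (k : ℕ) := by simp [hk']
        rw [f1, f2, ← hint₁ k', hkk]
        refine integral_congr fun σ hσ => ?_
        rw [uIcc_of_le (by simp)] at hσ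
        have hσ' : σ ≤ n := le_trans hσ.2 hle
        rw [hdy_le σ hσ']
      · have hkn : (k : ℕ) = n := by omega
        have hkr : (k : ℝ) = n := by exact_mod_cast hkn
        have e1 : A k.castSucc = P := by
          rw [hP]; congr 1; ext; simp [hkn]
        have e2 : A k.succ = Q := by
          rw [hQ]; congr 1; ext; simp [hkn]
        rw [hkr, e1, e2]
        have hcongr : ∫ σ in (n : ℝ)..(n + 1), ‖dy σ‖ = ∫ σ in (n : ℝ)..(n + 1), (6 * (σ - n) * (1 - (σ - n))) * ‖Q - P‖ := by
          refine integral_congr fun σ hσ => ?_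
          rw [uIcc_of_le (by simp)] at hσ
          rw [hdy_ge σ hσ.1]
          simp only [hdy₂]
          rw [norm_mul, Complex.norm_real, Real.norm_eq_abs,
            abs_of_nonneg (mul_nonneg (by linarith [hσ.1]) (by linarith [hσ.2]))]
        rw [hcongr, intervalIntegral.integral_mul_const]
        have hshift : ∫ σ in (n : ℝ)..(n + 1), 6 * (σ - n) * (1 - (σ - n)) = ∫ s in (0 : ℝ)..1, 6 * s * (1 - s) := by
          have := intervalIntegral.integral_comp_sub_right (fun s : ℝ => 6 * s * (1 - s)) (n : ℝ) (a := (n : ℝ)) (b := n + 1)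
          simpa using this
        rw [hshift, integral_smoothstep_deriv, one_mul]

/-- Every parameter of `[0, n]` (`n ≥ 1`) lies in some cell `[k, k+1]`, `k < n`. [folklore] -/
theorem exists_fin_mem_Icc {n : ℕ} (hn : 0 < n) {σ : ℝ} (hσ : σ ∈ Icc (0 : ℝ) n) : ∃ k : Fin n, σ ∈ Icc (k : ℝ) (k + 1) := by
  set m : ℕ := min ⌊σ⌋₊ (n - 1) with hm
  have hmn : m < n := by omega
  refine ⟨⟨m, hmn⟩, ?_, ?_⟩
  · have h1 : (m : ℝ) ≤ ⌊σ⌋₊ := by exact_mod_cast min_le_left _ _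
    exact h1.trans (Nat.floor_le hσ.1)
  · simp only
    rcases le_or_gt ⌊σ⌋₊ (n - 1) with h | h
    · have : m = ⌊σ⌋₊ := by rw [hm, min_eq_left h]
      rw [this]
      exact (Nat.lt_floor_add_one σ).le
    · have : m = n - 1 := by rw [hm, min_eq_right h.le]
      rw [this]
      have : ((n - 1 : ℕ) : ℝ) + 1 = n := by
        rw [Nat.cast_sub (by omega)]; push_cast; ring
      rw [this]; exact hσ.2

end Literature.Analysis.Calculus

end
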